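import Literature.MathematicalPhysics.QuantumFieldTheory.AnisotropicTwistedPartitionFunction
import Literature.MathematicalPhysics.QuantumFieldTheory.WilsonFinTorusPartition
import Literature.MathematicalPhysics.QuantumFieldTheory.FiniteTemperatureTYTwistBound
import HarnessLib

/-!
# Dictionary: 't Hooft's temporal-plane twisted partition function of the anisotropic `Fin`-box `L_s³ × L_t` is the
# Borgs–Seiler finite-temperature expectation of the stack-twist observable

Topic `Literature/MathematicalPhysics/QuantumFieldTheory`.  `twistedPartitionFunctionAniso ρ β L_s L_t z (0,3)`
(`AnisotropicTwistedPartitionFunction.lean`: the twist `z` multiplies the `(0,3)`-plaquettes based at `x₀ = 0 = x₃`) is, after the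
link reindexing `finTorusConfigEquiv : FiniteTemperature.Config 3 L_t L_s G ≃ᵐ (FinTorusSite L_s L_s L_s L_t × Fin 4 → G)`
(`WilsonFinTorusPartition.lean`; time = the last `Fin`-axis ↔ Borgs–Seiler's first coordinate, `Fin`-direction `0 ↦ some 0`,
`3 ↦ none`), the un-normalised finite-temperature expectation of the stack-twist observable
`stackTwistObs ρ β z⁻¹ 0 0 = exp(β Σ_{y : y₀ = 0} (Re tr ρ(z⁻¹ U_{(0,y);t,x₀}) − Re tr ρ(U_{(0,y);t,x₀})))` of
`FiniteTemperatureTYTwistBound.lean` — with `z⁻¹` because the `Fin`-box plaquette `(x; 0, 3)` is the finite-temperature plaquette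
`((t,y); x₀, t)` traversed in the opposite orientation (`plaquette_swap`), and `Re tr ρ(z P⁻¹) = Re tr ρ(z⁻¹ P)` for unitary `ρ`:

* `trace_re_rep_mul_inv_eq` — `Re tr ρ(z P⁻¹) = Re tr ρ(z⁻¹ P)` (unitary `ρ`);
* `neg_mul_sum_twist03_finTorusPlaquette_comp` — the twisted Wilson exponent of the reindexed configuration is
  `−L_t c_{β,L_s} + minusAction ρ β β U + β · elecStackDiff ρ z⁻¹ 0 0 U`;
* ★ `twistedPartitionFunctionAniso_03_eq_exp_mul_integral_stackTwistObs` —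
  `Z_β(z; (0,3); L_s, L_t) = e^{−L_t c_{β,L_s}} ∫ stackTwistObs ρ β z⁻¹ 0 0 U · e^{−S(U)} dU`;
* ★ `twistedPartitionFunctionAniso_03_div_eq` — the electric-flux ratio
  `Z_β(z; (0,3); L_s, L_t) / Z_β(1; (0,3); L_s, L_t) = (∫ stackTwistObs ρ β z⁻¹ 0 0 · e^{−S}) / ∫ e^{−S}`.

HONEST FRAMING: pure bookkeeping between two formalisations of the same Wilson action (Borgs–Seiler (II.20)–(II.22) with
`J_E = J_M = β`; Montvay–Münster (3.139)–(3.145)); no estimate is proved here.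

References: C. Borgs, E. Seiler, Commun. Math. Phys. 91 (1983) 329 [BorgsSeiler1983] §II.3; G. 't Hooft, Nucl. Phys. B153 (1979)
141 [tHooft1979Flux] §2; I. Montvay, G. Münster, Quantum Fields on a Lattice (1994) [MontvayMunster1994] §3.2.6.
-/

noncomputable section

open MeasureTheory
open scoped BigOperators
open Literature.Barriers.QuantumFields

namespace Literature.MathematicalPhysics.QuantumFieldTheory

variable {G : Type*} [Group G] {N : ℕ} (ρ : G →* Matrix (Fin N) (Fin N) ℂ) [TopologicalSpace G]
  [IsTopologicalGroup G] [CompactSpace G] [MeasurableSpace G] [BorelSpace G] {Ls Lt : ℕ} [NeZero Ls] [NeZero Lt]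

omit [TopologicalSpace G] [IsTopologicalGroup G] [CompactSpace G] [MeasurableSpace G] [BorelSpace G] [NeZero Ls] [NeZero Lt] in
/-- `Re tr ρ(z P⁻¹) = Re tr ρ(z⁻¹ P)` for unitary `ρ` (`Re tr ρ(g⁻¹) = Re tr ρ(g)` and cyclicity of the trace).
[cite: BorgsSeiler1983, §II.2 (p. 332)] -/
theorem trace_re_rep_mul_inv_eq (hρu : ∀ g, ρ g ∈ Matrix.unitaryGroup (Fin N) ℂ) (z P : G) :
    (ρ (z * P⁻¹)).trace.re = (ρ (z⁻¹ * P)).trace.re := by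
  rw [← FiniteTemperature.trace_re_rep_inv ρ hρu (z * P⁻¹), mul_inv_rev, inv_inv, map_mul, map_mul, Matrix.trace_mul_comm]

omit [TopologicalSpace G] [IsTopologicalGroup G] [CompactSpace G] [MeasurableSpace G] [BorelSpace G] in
/-- **The `(0,3)`-twisted Wilson exponent of the reindexed configuration** (unitary `ρ`):
`−β Σ_x Σ_{μ<ν} (N − Re tr ρ(t_z(x;μ,ν) pl)) = −L_t c_{β,L_s} + minusAction ρ β β U + β · elecStackDiff ρ z⁻¹ 0 0 U` — the untwisted part is
`neg_mul_sum_finTorusPlaquette_comp`, and the twisted `(0,3)`-plaquettes based at `x₀ = 0 = x₃` are the temporal plaquettes `((0,y); t, x₀)`,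
`y₀ = 0`, reversed. [cite: BorgsSeiler1983, §II.3 (II.20)–(II.22) (pp. 335–337)] [cite: tHooft1979Flux, §2 (2.5)–(2.6)] -/
theorem neg_mul_sum_twist03_finTorusPlaquette_comp (hρu : ∀ g, ρ g ∈ Matrix.unitaryGroup (Fin N) ℂ) (β : ℝ) (z : G)
    (U : FiniteTemperature.Config 3 Lt Ls G) :
    -β * ∑ x : FinTorusSite Ls Ls Ls Lt, ∑ q' : {p : Fin 4 × Fin 4 // p.1 < p.2},
        ((N : ℝ) - (ρ ((if q' = ⟨((0 : Fin 4), (3 : Fin 4)), by decide⟩ ∧ finTorusSiteCoord x (0 : Fin 4) = 0 ∧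
            finTorusSiteCoord x (3 : Fin 4) = 0 then z else 1) *
          finTorusPlaquette (fun l => U (finTorusSiteEquiv Ls Lt l.1, finTorusDirEquiv l.2)) x q'.1.1 q'.1.2)).trace.re) =
      (-((Lt : ℝ) * sliceKernelConst N β Ls) + FiniteTemperature.minusAction ρ β β U) +
        β * FiniteTemperature.elecStackDiff ρ z⁻¹ (0 : Fin 3) 0 U := by
  -- notation
  set V : FinTorusSite Ls Ls Ls Lt × Fin 4 → G := fun l => U (finTorusSiteEquiv Ls Lt l.1, finTorusDirEquiv l.2) with hV
  set q₀ : {p : Fin 4 × Fin 4 // p.1 < p.2} := ⟨((0 : Fin 4), (3 : Fin 4)), by decide⟩ with hq₀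
  -- the twisted difference at a site
  set g : FiniteTemperature.Site 3 Lt Ls → ℝ := fun s =>
    (ρ (z⁻¹ * FiniteTemperature.plaquette U s none (some 0))).trace.re -
      (ρ (FiniteTemperature.plaquette U s none (some 0))).trace.re with hg
  -- the twisted plaquette `(x; 0, 3)` is the reversed temporal plaquette at `σ x`
  have hpl : ∀ x : FinTorusSite Ls Ls Ls Lt,
      (ρ (z * finTorusPlaquette V x (0 : Fin 4) (3 : Fin 4))).trace.re -
          (ρ (finTorusPlaquette V x (0 : Fin 4) (3 : Fin 4))).trace.re = g (finTorusSiteEquiv Ls Lt x) := by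
    intro x
    have h03 : finTorusPlaquette V x (0 : Fin 4) (3 : Fin 4) =
        (FiniteTemperature.plaquette U (finTorusSiteEquiv Ls Lt x) none (some 0))⁻¹ := by
      rw [hV, finTorusPlaquette_comp, show finTorusDirEquiv (0 : Fin 4) = some (0 : Fin 3) from rfl,
        show finTorusDirEquiv (3 : Fin 4) = none from rfl, FiniteTemperature.plaquette_swap]
    rw [h03, trace_re_rep_mul_inv_eq ρ hρu, FiniteTemperature.trace_re_rep_inv ρ hρu]
  -- split each site's sum into the untwisted part and the twisted correction
  have hsite : ∀ x : FinTorusSite Ls Ls Ls Lt,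
      ∑ q' : {p : Fin 4 × Fin 4 // p.1 < p.2},
          ((N : ℝ) - (ρ ((if q' = q₀ ∧ finTorusSiteCoord x (0 : Fin 4) = 0 ∧ finTorusSiteCoord x (3 : Fin 4) = 0 then z
            else 1) * finTorusPlaquette V x q'.1.1 q'.1.2)).trace.re) =
        ∑ q' : {p : Fin 4 × Fin 4 // p.1 < p.2}, ((N : ℝ) - (ρ (finTorusPlaquette V x q'.1.1 q'.1.2)).trace.re) -
          if finTorusSiteCoord x (0 : Fin 4) = 0 ∧ finTorusSiteCoord x (3 : Fin 4) = 0 then g (finTorusSiteEquiv Ls Lt x)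
          else 0 := by
    intro x
    have hsum : ∑ q' : {p : Fin 4 × Fin 4 // p.1 < p.2},
        ((ρ ((if q' = q₀ ∧ finTorusSiteCoord x (0 : Fin 4) = 0 ∧ finTorusSiteCoord x (3 : Fin 4) = 0 then z else 1) *
            finTorusPlaquette V x q'.1.1 q'.1.2)).trace.re - (ρ (finTorusPlaquette V x q'.1.1 q'.1.2)).trace.re) =
        if finTorusSiteCoord x (0 : Fin 4) = 0 ∧ finTorusSiteCoord x (3 : Fin 4) = 0 then g (finTorusSiteEquiv Ls Lt x)
        else 0 := by
      rw [Finset.sum_eq_single q₀ (fun q' _ hq' => by simp [hq']) (fun h => (h (Finset.mem_univ _)).elim)]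
      by_cases hc : finTorusSiteCoord x (0 : Fin 4) = 0 ∧ finTorusSiteCoord x (3 : Fin 4) = 0
      · rw [if_pos ⟨rfl, hc⟩, if_pos hc, ← hpl x]
      · rw [if_neg (fun h => hc h.2), if_neg hc, one_mul, sub_self]
    rw [← hsum, ← Finset.sum_sub_distrib]
    refine Finset.sum_congr rfl fun q' _ => ?_
    ring
  -- the twisted correction summed over the box is the stack sum
  have hcoord : ∀ x : FinTorusSite Ls Ls Ls Lt,
      (finTorusSiteCoord x (0 : Fin 4) = 0 ∧ finTorusSiteCoord x (3 : Fin 4) = 0) ↔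
        ((finTorusSiteEquiv Ls Lt x).1 = 0 ∧ (finTorusSiteEquiv Ls Lt x).2 0 = 0) := by
    intro x
    rw [show finTorusSiteCoord x 0 = (x.1 : ℕ) from rfl, show finTorusSiteCoord x 3 = (x.2.2.2 : ℕ) from rfl,
      Fin.val_eq_zero_iff, Fin.val_eq_zero_iff, and_comm]
    simp [finTorusSiteEquiv]
  have hstack : ∑ x : FinTorusSite Ls Ls Ls Lt,
      (if finTorusSiteCoord x (0 : Fin 4) = 0 ∧ finTorusSiteCoord x (3 : Fin 4) = 0 then g (finTorusSiteEquiv Ls Lt x) else 0) =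
        FiniteTemperature.elecStackDiff ρ z⁻¹ (0 : Fin 3) 0 U := by
    simp_rw [hcoord]
    rw [Fintype.sum_equiv (finTorusSiteEquiv Ls Lt) _ (fun s : FiniteTemperature.Site 3 Lt Ls =>
      if s.1 = 0 ∧ s.2 0 = 0 then g s else 0) (fun x => rfl)]
    rw [FiniteTemperature.elecStackDiff, Fintype.sum_prod_type]
    simp_rw [ite_and]
    rw [Finset.sum_comm]
    refine Finset.sum_congr rfl fun y _ => ?_
    rw [Finset.sum_ite_eq' Finset.univ (0 : ZMod Lt), if_pos (Finset.mem_univ _)]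
  -- assemble
  simp_rw [hsite]
  rw [Finset.sum_sub_distrib, hstack, mul_sub, hV, neg_mul_sum_finTorusPlaquette_comp ρ hρu β U]
  ring

/-- **★ Dictionary.**  't Hooft's `(0,3)`-twisted partition function of `L_s³ × L_t` is `e^{−L_t c_{β,L_s}}` times the un-normalised
finite-temperature expectation of the stack-twist observable with `z⁻¹` (unitary `ρ`; `L_s, L_t ≥ 1`):
`Z_β(z; (0,3); L_s, L_t) = e^{−L_t c_{β,L_s}} ∫ stackTwistObs ρ β z⁻¹ 0 0 U · e^{−S_{β,β}(U)} dU` on `ℤ_{L_t} × (ℤ/L_s)³`.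
[cite: BorgsSeiler1983, §II.3 (II.20)–(II.22) (pp. 335–337)] [cite: tHooft1979Flux, §2 (2.5)–(2.6)] [cite: MontvayMunster1994, §3.2.6 (3.139)–(3.145)] -/
theorem twistedPartitionFunctionAniso_03_eq_exp_mul_integral_stackTwistObs (hρu : ∀ g, ρ g ∈ Matrix.unitaryGroup (Fin N) ℂ)
    (β : ℝ) (z : G) :
    twistedPartitionFunctionAniso ρ β Ls Lt z ⟨((0 : Fin 4), (3 : Fin 4)), by decide⟩ =
      Real.exp (-((Lt : ℝ) * sliceKernelConst N β Ls)) *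
        ∫ U, FiniteTemperature.stackTwistObs ρ β z⁻¹ (0 : Fin 3) 0 U * FiniteTemperature.weight ρ β β U
          ∂(FiniteTemperature.haar 3 Lt Ls G) := by
  rw [twistedPartitionFunctionAniso_eq_integral,
    ← (measurePreserving_finTorusConfigEquiv (G := G) (L := Ls) (T := Lt)).integral_comp', ← integral_const_mul]
  refine integral_congr_ae (Filter.Eventually.of_forall fun U => ?_)
  dsimp only
  rw [coe_finTorusConfigEquiv]
  dsimp only
  rw [neg_mul_sum_twist03_finTorusPlaquette_comp ρ hρu β z U, Real.exp_add, Real.exp_add, FiniteTemperature.weight,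
    FiniteTemperature.stackTwistObs]
  ring

/-- **★ The electric-flux ratio as a finite-temperature expectation** (unitary `ρ`; `L_s, L_t ≥ 1`):
`Z_β(z; (0,3); L_s, L_t) / Z_β(1; (0,3); L_s, L_t) = (∫ stackTwistObs ρ β z⁻¹ 0 0 · e^{−S}) / ∫ e^{−S}` on `ℤ_{L_t} × (ℤ/L_s)³`
(the constant `e^{−L_t c_{β,L_s}}` cancels). [cite: BorgsSeiler1983, §II.3 (II.22) (p. 337)] [cite: tHooft1979Flux, §2 (2.6)] -/
theorem twistedPartitionFunctionAniso_03_div_eq (hρu : ∀ g, ρ g ∈ Matrix.unitaryGroup (Fin N) ℂ) (β : ℝ) (z : G) :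
    twistedPartitionFunctionAniso ρ β Ls Lt z ⟨((0 : Fin 4), (3 : Fin 4)), by decide⟩ /
        twistedPartitionFunctionAniso ρ β Ls Lt 1 ⟨((0 : Fin 4), (3 : Fin 4)), by decide⟩ =
      (∫ U, FiniteTemperature.stackTwistObs ρ β z⁻¹ (0 : Fin 3) 0 U * FiniteTemperature.weight ρ β β U
          ∂(FiniteTemperature.haar 3 Lt Ls G)) /
        ∫ U, FiniteTemperature.weight ρ β β U ∂(FiniteTemperature.haar 3 Lt Ls G) := by
  rw [twistedPartitionFunctionAniso_03_eq_exp_mul_integral_stackTwistObs ρ hρu β z, twistedPartitionFunctionAniso_one,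
    wilsonFinTorusPartition_eq_exp_mul_integral_weight hρu β Ls Lt, mul_div_mul_left _ _ (Real.exp_pos _).ne']

end Literature.MathematicalPhysics.QuantumFieldTheory
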